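import Literature.Barriers.CriticalPhenomena.GridSAWCountingViaGridHamPath
import HarnessLib

/-!
# Grid drawings keyed by vertex names, and their numbering into `GRIDHAMPATHCOUNT` instances

An instance of `GRIDHAMPATHCOUNT` (`GridSAWCountingViaGridHamPath.lean`) presents a graph of
maximum degree three by a congestion-free grid drawing `(P, D)` whose vertices are the NUMBERS
`0, …, |P| - 1` (`IsGridDrawing P D`; edges `(i, j, π)` with `π` the realising grid path). The
graphs one actually draws — the gadget graph `G′(ψ)` of Liśkiewicz–Ogihara–Toda 2003, §3–§4
(`LOT2003_lemma4_gadgets`: "we apply our embedding algorithm to `G′` and obtain a subgraph of a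
two-dimensional grid … This is `E₀`") — have NAMED vertices (cycle nodes, gadget copies, …), and
are assembled from components. This file separates the two concerns:

* `SDrawing α` — a drawing keyed by vertex names: a vertex list `verts` (its order is the
  numbering), positions `pos : α → GridPoint`, and named drawn edges `(a, b, π)`;
  `SDrawing.IsValid` — the same conditions as `IsGridDrawing`, stated on names (distinct
  positions, correct self-avoiding grid paths meeting vertex positions only at their ends, no
  parallel edges, interiors pairwise disjoint, degrees at most three);
* `SDrawing.toP`, `SDrawing.toD` — the numbered instance (`idx a` = position of `a` in
  `verts`), with **`SDrawing.IsValid.isGridDrawing : IsGridDrawing S.toP S.toD`**, the degree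
  and adjacency dictionaries `drawnDegree_toD`, `dAdj_toD_iff`, and `length_toP`, `getElem?_toP`.

Combined with `hamPathCount_eq_hamCount_of_numbering` (`GridSAWHamPathCountTransfer.lean`) this
turns a census proved for a named graph into the value of `GRIDHAMPATHCOUNT` on the code of
`(S.toP, S.toD, idx s, idx t)`.

## References

* M. Liśkiewicz, M. Ogihara, S. Toda, TCS 304 (2003) 129–156, §4 (proof of Theorem 7, `E₀`:
  "for every two edges the paths which realize the edges in the two-dimensional grid are vertex
  disjoint").
-/

namespace Literature.Barriers.CriticalPhenomena.GridSAW

/-- A drawn edge keyed by vertex names: end vertices `a`, `b` and the realising grid path from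
the position of `a` to the position of `b`. [cite: LiskiewiczOgiharaToda2003, §4 (proof of Theorem 7)] -/
abbrev SEdge (α : Type*) : Type _ := α × α × List GridPoint

/-- **A grid drawing keyed by vertex names**: the vertex list (its order is the numbering of the
instance), the positions, and the named drawn edges. [cite: LiskiewiczOgiharaToda2003, §4 (proof of Theorem 7, E₀)] -/
structure SDrawing (α : Type*) where
  /-- the vertices, in numbering order -/
  verts : List α
  /-- the grid point at which each vertex is drawn -/
  pos : α → GridPoint
  /-- the drawn edges `(a, b, π)` -/
  edges : List (SEdge α)

namespace SDrawing

variable {α : Type*} [DecidableEq α] (S : SDrawing α)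

/-- The number of the vertex `a` (its position in `verts`; `|verts|` if absent). [folklore] -/
def idx (a : α) : ℕ := S.verts.idxOf a

/-- The vertex images of the numbered instance. [folklore] -/
def toP : List GridPoint := S.verts.map S.pos

/-- The drawn edges of the numbered instance. [folklore] -/
def toD : List DrawnEdge := S.edges.map fun e => (S.idx e.1, S.idx e.2.1, e.2.2)

/-- The number of drawn edges at the vertex `a`. [folklore] -/
def degree (a : α) : ℕ := S.edges.countP fun e => decide (e.1 = a ∨ e.2.1 = a)

/-- Two named edges have the same ends (in either order). [folklore] -/
def SameEndsS (e e' : SEdge α) : Prop :=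
  (e.1 = e'.1 ∧ e.2.1 = e'.2.1) ∨ (e.1 = e'.2.1 ∧ e.2.1 = e'.1)

/-- **Validity of a named drawing** — the conditions of `IsGridDrawing`, on names: distinct
vertices at distinct positions; every edge joins two distinct listed vertices by a self-avoiding
grid path from the position of the first to that of the second which meets vertex positions
only at its ends; no two edges with the same ends; a grid point on two edges is a vertex
position; every vertex on at most three edges.
[cite: LiskiewiczOgiharaToda2003, §2.3 (#HamPath-Plan3) and §4 (proof of Theorem 7, E₀)] -/
structure IsValid : Prop where
  /-- vertices listed once -/
  nodup_verts : S.verts.Nodup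
  /-- distinct vertices at distinct points -/
  pos_inj : ∀ a ∈ S.verts, ∀ b ∈ S.verts, S.pos a = S.pos b → a = b
  /-- ends are listed vertices -/
  fst_mem : ∀ e ∈ S.edges, e.1 ∈ S.verts
  /-- ends are listed vertices -/
  snd_mem : ∀ e ∈ S.edges, e.2.1 ∈ S.verts
  /-- no loops -/
  fst_ne_snd : ∀ e ∈ S.edges, e.1 ≠ e.2.1
  /-- the path starts at the first end -/
  head?_eq : ∀ e ∈ S.edges, e.2.2.head? = some (S.pos e.1)
  /-- the path ends at the second end -/
  getLast?_eq : ∀ e ∈ S.edges, e.2.2.getLast? = some (S.pos e.2.1)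
  /-- the path is self-avoiding -/
  nodup_path : ∀ e ∈ S.edges, e.2.2.Nodup
  /-- the path is a grid path -/
  isChain_path : ∀ e ∈ S.edges, List.IsChain IsGridEdge e.2.2
  /-- the path meets vertex positions only at its ends -/
  interior : ∀ e ∈ S.edges, ∀ v ∈ S.verts, S.pos v ∈ e.2.2 → v = e.1 ∨ v = e.2.1
  /-- no parallel edges -/
  simple : S.edges.Pairwise fun e e' => ¬ SameEndsS e e'
  /-- congestion-free: a common point of two edges is a vertex position -/
  disjoint : S.edges.Pairwise fun e e' => ∀ p ∈ e.2.2, p ∈ e'.2.2 → ∃ v ∈ S.verts, S.pos v = p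
  /-- maximum degree three -/
  degree_le : ∀ v ∈ S.verts, S.degree v ≤ 3

/-! ### The numbering -/

omit [DecidableEq α] in
/-- The instance has one image per listed vertex. [folklore] -/
@[simp] theorem length_toP : S.toP.length = S.verts.length := List.length_map _

/-- A listed vertex has a number below `|verts|`. [folklore] -/
theorem idx_lt_length {a : α} (ha : a ∈ S.verts) : S.idx a < S.verts.length :=
  List.idxOf_lt_length_of_mem ha

/-- Numbers of listed vertices are injective. [folklore] -/
theorem idx_inj {a b : α} (ha : a ∈ S.verts) : S.idx a = S.idx b ↔ a = b :=
  List.idxOf_inj ha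

/-- The vertex with a given number. [folklore] -/
theorem verts_getElem_idx {a : α} (ha : a ∈ S.verts) :
    S.verts[S.idx a]'(S.idx_lt_length ha) = a :=
  List.getElem_idxOf _

/-- The image of vertex number `idx a` is the position of `a`. [folklore] -/
theorem getElem?_toP {a : α} (ha : a ∈ S.verts) : S.toP[S.idx a]? = some (S.pos a) := by
  rw [toP, List.getElem?_map, List.getElem?_eq_getElem (S.idx_lt_length ha),
    S.verts_getElem_idx ha]
  rfl

/-- Every number below `|verts|` is the number of a listed vertex. [folklore] -/
theorem exists_eq_idx (hS : S.verts.Nodup) {n : ℕ} (hn : n < S.verts.length) :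
    ∃ a ∈ S.verts, S.idx a = n :=
  ⟨S.verts[n], List.getElem_mem hn, hS.idxOf_getElem n hn⟩

omit [DecidableEq α] in
/-- The images are the positions of the listed vertices. [folklore] -/
theorem mem_toP_iff {p : GridPoint} : p ∈ S.toP ↔ ∃ v ∈ S.verts, S.pos v = p := by
  simp [toP]

/-- Members of `toD` come from named edges. [folklore] -/
theorem mem_toD_iff {d : DrawnEdge} :
    d ∈ S.toD ↔ ∃ e ∈ S.edges, (S.idx e.1, S.idx e.2.1, e.2.2) = d := by
  simp [toD]

/-! ### Validity transfers to the numbered instance -/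

variable {S}

/-- The vertex images of a valid drawing are pairwise distinct. [folklore] -/
theorem IsValid.nodup_toP (h : S.IsValid) : S.toP.Nodup := by
  rw [toP]
  exact h.nodup_verts.map_on fun a ha b hb hab => h.pos_inj a ha b hb hab

/-- Every drawn edge of the numbered instance is correctly drawn. [folklore] -/
theorem IsValid.isDrawnEdgeOf (h : S.IsValid) {e : SEdge α} (he : e ∈ S.edges) :
    IsDrawnEdgeOf S.toP (S.idx e.1, S.idx e.2.1, e.2.2) := by
  have h1 := h.fst_mem e he
  have h2 := h.snd_mem e he
  refine ⟨by rw [length_toP]; exact S.idx_lt_length h1,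
    by rw [length_toP]; exact S.idx_lt_length h2,
    fun heq => h.fst_ne_snd e he ((S.idx_inj h1).1 heq), ?_, ?_, h.nodup_path e he,
    h.isChain_path e he, ?_⟩
  · change e.2.2.head? = S.toP[S.idx e.1]?
    rw [S.getElem?_toP h1, h.head?_eq e he]
  · change e.2.2.getLast? = S.toP[S.idx e.2.1]?
    rw [S.getElem?_toP h2, h.getLast?_eq e he]
  · intro p hp hpP
    change S.toP[S.idx e.1]? = some p ∨ S.toP[S.idx e.2.1]? = some p
    obtain ⟨v, hv, rfl⟩ := S.mem_toP_iff.1 hpP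
    rcases h.interior e he v hv hp with rfl | rfl
    · exact Or.inl (S.getElem?_toP h1)
    · exact Or.inr (S.getElem?_toP h2)

/-- **Degrees are preserved by the numbering.** [folklore] -/
theorem IsValid.drawnDegree_toD (h : S.IsValid) (a : α) :
    drawnDegree S.toD (S.idx a) = S.degree a := by
  rw [drawnDegree, toD, List.countP_map, degree]
  refine List.countP_congr fun e he => ?_
  simp only [Function.comp_apply, decide_eq_true_eq]
  rw [S.idx_inj (h.fst_mem e he), S.idx_inj (h.snd_mem e he)]

/-- **Adjacency dictionary**: two listed vertices are adjacent in the numbered instance iff a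
named edge joins them. [folklore] -/
theorem IsValid.dAdj_toD_iff (h : S.IsValid) {a b : α} (ha : a ∈ S.verts) (hb : b ∈ S.verts) :
    DAdj S.toD (S.idx a) (S.idx b) ↔
      ∃ e ∈ S.edges, (e.1 = a ∧ e.2.1 = b) ∨ (e.1 = b ∧ e.2.1 = a) := by
  unfold DAdj
  constructor
  · rintro ⟨d, hd, hends⟩
    obtain ⟨e, he, rfl⟩ := S.mem_toD_iff.1 hd
    refine ⟨e, he, ?_⟩
    simp only at hends
    rw [S.idx_inj (h.fst_mem e he), S.idx_inj (h.snd_mem e he),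
      S.idx_inj (h.fst_mem e he), S.idx_inj (h.snd_mem e he)] at hends
    exact hends
  · rintro ⟨e, he, hends⟩
    refine ⟨_, S.mem_toD_iff.2 ⟨e, he, rfl⟩, ?_⟩
    simp only
    rcases hends with ⟨rfl, rfl⟩ | ⟨rfl, rfl⟩
    exacts [Or.inl ⟨rfl, rfl⟩, Or.inr ⟨rfl, rfl⟩]

/-- **A valid named drawing numbers to a congestion-free grid drawing** of a simple graph of
maximum degree three (`IsGridDrawing`). [cite: LiskiewiczOgiharaToda2003, §4 (proof of Theorem 7, E₀)] -/
theorem IsValid.isGridDrawing (h : S.IsValid) : IsGridDrawing S.toP S.toD := by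
  refine ⟨h.nodup_toP, fun d hd => ?_, ?_, ?_, fun n hn => ?_⟩
  · obtain ⟨e, he, rfl⟩ := S.mem_toD_iff.1 hd
    exact h.isDrawnEdgeOf he
  · rw [toD, List.pairwise_map]
    refine h.simple.imp_of_mem fun {e e'} he he' hne hsame => hne ?_
    unfold SameEnds at hsame
    unfold SameEndsS
    simp only at hsame
    rw [S.idx_inj (h.fst_mem e he), S.idx_inj (h.snd_mem e he), S.idx_inj (h.fst_mem e he),
      S.idx_inj (h.snd_mem e he)] at hsame
    exact hsame
  · rw [toD, List.pairwise_map]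
    refine h.disjoint.imp fun {e e'} hcommon p hp hp' => ?_
    obtain ⟨v, hv, rfl⟩ := hcommon p hp hp'
    exact S.mem_toP_iff.2 ⟨v, hv, rfl⟩
  · rw [length_toP] at hn
    obtain ⟨a, ha, rfl⟩ := S.exists_eq_idx h.nodup_verts hn
    rw [h.drawnDegree_toD a]
    exact h.degree_le a ha

/-- The numbers of the listed vertices are exactly `0, …, |verts| - 1`. [folklore] -/
theorem image_idx_eq_range (S : SDrawing α) (hS : S.verts.Nodup) :
    S.verts.toFinset.image S.idx = Finset.range S.verts.length := by
  ext n
  simp only [Finset.mem_image, List.mem_toFinset, Finset.mem_range]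
  constructor
  · rintro ⟨a, ha, rfl⟩
    exact S.idx_lt_length ha
  · intro hn
    exact S.exists_eq_idx hS hn

end SDrawing

/-! ### Sanity check -/

/-- The one-edge graph `u — v` drawn on the unit grid edge, keyed by `Bool` names. [folklore] -/
def oneEdgeSDrawing : SDrawing Bool where
  verts := [false, true]
  pos := fun b => if b then (0, 1) else (0, 0)
  edges := [(false, true, [((0 : ℤ), (0 : ℤ)), (0, 1)])]

/-- Its numbered instance is the one-edge drawing of `GridSAWCountingViaGridHamPath.lean`
(by `decide`). [folklore] -/
theorem oneEdgeSDrawing_toPD :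
    oneEdgeSDrawing.toP = oneEdgeDrawing.1 ∧ oneEdgeSDrawing.toD = oneEdgeDrawing.2 := by
  decide

end Literature.Barriers.CriticalPhenomena.GridSAW
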